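import Mathlib
import Summits.Ventures.PercRepro.TriangleCapRowTGen
import Summits.Ventures.PercRepro.TriangleCapBelowBig

/-!
# PercRepro — THE ROWS r = a − 2 AND r = a − 1 FOR EVERY ROW a ≥ 5: the theorems of the source module re-derived WITHOUT the bound through
`below_second_order_every` (part 204b) in place of `below_second_order_all` (p3, gen 49; part 204c)

The proofs are those of the source module verbatim; the bound `a ≤ 18` entered them only through the `B2` regime
`below_second_order_all` of part 200zi (the corner `k = 2a + r`, now `below_corner_every`) and through the earlier
rows. Axioms: standard.
-/

namespace PercRepro

namespace TriangleCap

namespace C047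

open Finset

universe u

variable {V : Type*} [Fintype V] [DecidableEq V]

/-- **THE ROW `r = a − 2`, `5 ≤ a`, `k ≥ 3a − 2`:** `K₄⁻`-free, `m + r = a (k − a)` ⇒ `a`-bipartite or
`Σ_v d(v)² + r (k − 1 − r) + 2 (k − 2a − 1) ≤ m k`. -/
theorem rowT_second_order_gen_every (D : SimpleGraph V) [DecidableRel D.Adj] (hK : K4mFree D) (a r : ℕ)
    (ha5 : 5 ≤ a) (hr : r + 2 = a) (hk : 2 * a + r ≤ Fintype.card V)
    (hm : D.edgeFinset.card + r = a * (Fintype.card V - a)) :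
    (∃ A : Finset V, A.card = a ∧ BipSub D A) ∨
      ∑ v, deg D v * deg D v + r * (Fintype.card V - 1 - r) + 2 * (Fintype.card V - 2 * a - 1) ≤
        D.edgeFinset.card * Fintype.card V := by
  have hk2 : 2 * a + 2 ≤ Fintype.card V := by omega
  -- (A) a vertex at the cap
  by_cases hx : ∃ x, deg D x + a = Fintype.card V
  · obtain ⟨x, hx⟩ := hx
    exact cap_T_gen D hK a r ha5 (by omega) (by omega) hk hm (by omega) x hx
  push Not at hx
  have hcap : ∀ v, deg D v + a ≤ Fintype.card V := fun v =>
    deg_add_le_card_of_dense D hK a (by omega) (by omega)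
      (cap_arith a (Fintype.card V) D.edgeFinset.card r (by omega) hk
        (below_cap_arith a (Fintype.card V) D.edgeFinset.card r (by omega) hm)) v
  have hcap' : ∀ v, deg D v + a + 1 ≤ Fintype.card V := fun v => by
    have h1 := hcap v
    have h2 := hx v
    omega
  have hcap2 : ∀ v, deg D v ≤ (Fintype.card V - a - 2) + 1 := fun v => by have := hcap' v; omega
  -- (B) every degree `≥ a`: the window
  by_cases hdeg : ∀ v, a ≤ deg D v
  · exact Or.inr (rowT_window D a r (by omega) (by omega) (by omega) hm hcap' hdeg)
  push Not at hdeg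
  obtain ⟨z, hz⟩ := hdeg
  -- (C) `d ≤ 1`: the cross-row deletion
  rcases Nat.lt_or_ge (r + deg D z) a with hz1 | hz2
  · right
    have h := below_cross_gen D hK a r (by omega) hk2 hm hcap' z (by omega)
    have e : a - r = 2 := by omega
    rw [e] at h
    omega
  -- (D) `2 ≤ d ≤ a − 1`: onto the `B2` cell `(k − 1, a, d − 2)`
  obtain ⟨r', hr'⟩ : ∃ r', r + deg D z = a + r' := ⟨r + deg D z - a, by omega⟩
  have hK' := k4mFree_del D hK z
  have hcard' := card_del z
  have hedges' := card_edges_del D z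
  have hsq := sum_deg_sq_del D z
  have hT := sum_del_nbhd_le D z (Fintype.card V - a - 2) hcap2
  obtain ⟨T, hTdef⟩ : ∃ T, ∑ w : {v : V // v ≠ z}, (if D.Adj w.1 z then deg (del D z) w else 0) = T := ⟨_, rfl⟩
  obtain ⟨S', hS'def⟩ : ∃ S', ∑ w : {v : V // v ≠ z}, deg (del D z) w * deg (del D z) w = S' := ⟨_, rfl⟩
  obtain ⟨m', hm'def⟩ : ∃ m', (del D z).edgeFinset.card = m' := ⟨_, rfl⟩
  rw [hTdef, hS'def] at hsq
  rw [hTdef] at hT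
  rw [hm'def] at hedges'
  have hcardV' : Fintype.card {v : V // v ≠ z} = Fintype.card V - 1 := by omega
  have hm' : (del D z).edgeFinset.card + r' = a * (Fintype.card {v : V // v ≠ z} - a) := by
    rw [hm'def, hcardV']
    exact below_cell_edges a r r' (deg D z) (Fintype.card V) D.edgeFinset.card m' hk2 hr' hedges' hm
  have hmd : m' + deg D z + r = a * (Fintype.card V - a) := by omega
  rcases below_second_order_every (del D z) hK' a r' (by omega) (by omega) (by omega) hm'
    with ⟨A', hA'card, hB⟩ | hgap
  · rcases sides_T_gen D a r (by omega) hk2 hm z A' hA'card hB hcap2 with h | h | hT'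
    · exact Or.inl h
    · exact Or.inr h
    · right
      have hS := sum_deg_sq_le_of_bipSub (del D z) A' hB a r' hA'card hm' (by omega)
      rw [hS'def, hm'def, hcardV'] at hS
      rw [hTdef] at hT'
      rw [hsq, ← hedges']
      exact rowT_mixed_arith a r r' (deg D z) (Fintype.card V) m' S' T ha5 hr (by omega) (by omega) hk hr' hmd
        hS hT'
  · right
    rw [hS'def, hm'def, hcardV'] at hgap
    have h := below_within_assemble a r r' (deg D z) (Fintype.card V) m' S' T hk2 (by omega) hr' (by omega) hmd
      hgap hT
    rw [hsq, ← hedges']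
    have e : a - r = 2 := by omega
    rw [e] at h
    omega

/-- **THE ROW `r = a − 1`, `5 ≤ a`, `k ≥ 3a`:** `K₄⁻`-free, `m + r = a (k − a)` ⇒ `a`-bipartite or
`Σ_v d(v)² + r (k − 1 − r) + 2 (k − 2a − 1) ≤ m k`. -/
theorem rowB_second_order_gen_every (D : SimpleGraph V) [DecidableRel D.Adj] (hK : K4mFree D) (a r : ℕ)
    (ha5 : 5 ≤ a) (hr : r + 1 = a) (hk : 2 * a + r + 1 ≤ Fintype.card V)
    (hm : D.edgeFinset.card + r = a * (Fintype.card V - a)) :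
    (∃ A : Finset V, A.card = a ∧ BipSub D A) ∨
      ∑ v, deg D v * deg D v + r * (Fintype.card V - 1 - r) + 2 * (Fintype.card V - 2 * a - 1) ≤
        D.edgeFinset.card * Fintype.card V := by
  have hk2 : 2 * a + 2 ≤ Fintype.card V := by omega
  -- (A) a vertex at the cap
  by_cases hx : ∃ x, deg D x + a = Fintype.card V
  · obtain ⟨x, hx⟩ := hx
    exact cap_T_gen D hK a r ha5 (by omega) (by omega) (by omega) hm (by omega) x hx
  push Not at hx
  have hcap : ∀ v, deg D v + a ≤ Fintype.card V := fun v =>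
    deg_add_le_card_of_dense D hK a (by omega) (by omega)
      (cap_arith a (Fintype.card V) D.edgeFinset.card r (by omega) (by omega)
        (below_cap_arith a (Fintype.card V) D.edgeFinset.card r (by omega) hm)) v
  have hcap' : ∀ v, deg D v + a + 1 ≤ Fintype.card V := fun v => by
    have h1 := hcap v
    have h2 := hx v
    omega
  have hcap2 : ∀ v, deg D v ≤ (Fintype.card V - a - 2) + 1 := fun v => by have := hcap' v; omega
  -- (B) every degree `≥ a`: the window
  by_cases hdeg : ∀ v, a ≤ deg D v
  · exact Or.inr (rowT_window D a r (by omega) (by omega) (by omega) hm hcap' hdeg)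
  push Not at hdeg
  obtain ⟨z, hz⟩ := hdeg
  -- (C) `d = 0`: the cross-row deletion, exactly the target
  rcases Nat.lt_or_ge (r + deg D z) a with hz1 | hz2
  · right
    have h := below_cross_gen D hK a r (by omega) hk2 hm hcap' z (by omega)
    have e : a - r = 1 := by omega
    rw [e, mul_one] at h
    exact h
  -- (D) `1 ≤ d ≤ a − 1`: onto the cell `(k − 1, a, d − 1)`
  obtain ⟨r', hr'⟩ : ∃ r', r + deg D z = a + r' := ⟨r + deg D z - a, by omega⟩
  have hK' := k4mFree_del D hK z
  have hcard' := card_del z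
  have hedges' := card_edges_del D z
  have hsq := sum_deg_sq_del D z
  have hT := sum_del_nbhd_le D z (Fintype.card V - a - 2) hcap2
  obtain ⟨T, hTdef⟩ : ∃ T, ∑ w : {v : V // v ≠ z}, (if D.Adj w.1 z then deg (del D z) w else 0) = T := ⟨_, rfl⟩
  obtain ⟨S', hS'def⟩ : ∃ S', ∑ w : {v : V // v ≠ z}, deg (del D z) w * deg (del D z) w = S' := ⟨_, rfl⟩
  obtain ⟨m', hm'def⟩ : ∃ m', (del D z).edgeFinset.card = m' := ⟨_, rfl⟩
  rw [hTdef, hS'def] at hsq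
  rw [hTdef] at hT
  rw [hm'def] at hedges'
  have hcardV' : Fintype.card {v : V // v ≠ z} = Fintype.card V - 1 := by omega
  have hm' : (del D z).edgeFinset.card + r' = a * (Fintype.card {v : V // v ≠ z} - a) := by
    rw [hm'def, hcardV']
    exact below_cell_edges a r r' (deg D z) (Fintype.card V) D.edgeFinset.card m' hk2 hr' hedges' hm
  have hmd : m' + deg D z + r = a * (Fintype.card V - a) := by omega
  -- the side lemma, shared by every `d`
  have hside : ∀ A' : Finset {v : V // v ≠ z}, A'.card = a → BipSub (del D z) A' →
      (∃ A : Finset V, A.card = a ∧ BipSub D A) ∨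
        (∑ v, deg D v * deg D v + r * (Fintype.card V - 1 - r) + 2 * (Fintype.card V - 2 * a - 1) ≤
          D.edgeFinset.card * Fintype.card V) ∨
        (T + (Fintype.card V - a - 2) ≤ deg D z * (Fintype.card V - a - 2) + a) := by
    intro A' hA'card hB
    have := sides_T_gen D a r (by omega) hk2 hm z A' hA'card hB hcap2
    rw [hTdef] at this
    exact this
  rcases Nat.lt_or_ge (deg D z + 1) a with hda | hda
  · -- `d ≤ a − 2`: the `B2` cell `(k − 1, a, d − 1)`
    rcases below_second_order_every (del D z) hK' a r' (by omega) (by omega) (by omega) hm'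
      with ⟨A', hA'card, hB⟩ | hgap
    · rcases hside A' hA'card hB with h | h | hT'
      · exact Or.inl h
      · exact Or.inr h
      · right
        rcases Nat.lt_or_ge (deg D z) 2 with hd1 | hd2
        · -- `d = 1`: the envelope read, exactly the family `B2`
          have hd1' : deg D z = 1 := by omega
          have henv := sum_deg_sq_le_of_k4mFree (del D z) hK' (by omega)
          rw [hS'def, hm'def, hcardV'] at henv
          rw [hd1'] at hT' hedges'
          rw [hsq, ← hedges', hd1']
          exact rowB_env_arith a r (Fintype.card V) m' S' T ha5 hr (by omega) (by rw [hd1'] at hmd; exact hmd)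
            henv hT'
        · have hS := sum_deg_sq_le_of_bipSub (del D z) A' hB a r' hA'card hm' (by omega)
          rw [hS'def, hm'def, hcardV'] at hS
          rw [hsq, ← hedges']
          exact rowB_mixed_arith a r r' (deg D z) (Fintype.card V) m' S' T ha5 hr hd2 (by omega) (by omega) hr'
            hmd hS hT'
    · right
      rw [hS'def, hm'def, hcardV'] at hgap
      have h := below_within_assemble a r r' (deg D z) (Fintype.card V) m' S' T hk2 (by omega) hr' (by omega)
        hmd hgap hT
      rw [hsq, ← hedges']
      have e : a - r = 1 := by omega
      rw [e, mul_one] at h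
      exact h
  · -- `d = a − 1`: the `T` cell `(k − 1, a, a − 2)`
    have hda' : deg D z = a - 1 := by omega
    have hr'' : r' = a - 2 := by omega
    subst hr''
    rcases rowT_second_order_gen_every (del D z) hK' a (a - 2) ha5 (by omega) (by omega) hm'
      with ⟨A', hA'card, hB⟩ | hgap
    · rcases hside A' hA'card hB with h | h | hT'
      · exact Or.inl h
      · exact Or.inr h
      · right
        have hS := sum_deg_sq_le_of_bipSub (del D z) A' hB a (a - 2) hA'card hm' (by omega)
        rw [hS'def, hm'def, hcardV'] at hS
        rw [hsq, ← hedges']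
        exact rowB_mixed_arith a r (a - 2) (deg D z) (Fintype.card V) m' S' T ha5 hr (by omega) (by omega)
          (by omega) hr' hmd hS hT'
    · right
      rw [hS'def, hm'def, hcardV'] at hgap
      rw [hda'] at hT hedges' hmd
      rw [hsq, ← hedges', hda']
      exact rowB_T_arith a r (Fintype.card V) m' S' T ha5 hr (by omega) hmd hgap hT

end C047

end TriangleCap

end PercRepro
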